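import Literature.Geometry.Kaehler.ComplexTorusFourierLefschetzIntertwining
import HarnessLib

/-!
# The Fourier transform on the Lefschetz lattices of a polarised torus:
# `F(Hᵖ(X, ℤ)) = H^{2g−p}(X̂, ℤ)`, `F(Hᵇ(X, ℤ) ∩ ker L_θ) = H^{m+2}(X̂, ℤ) ∩ P^{m+2}(X̂, E_δ)`,
# `F(θ ∪ Hᵇ(X, ℤ)) = d₁d_g·Λ_{E_δ}(H^{m+2}(X̂, ℤ))`, and `[H^{b+2}(X, ℤ) : θ ∪ Hᵇ(X, ℤ)] = [Hᵐ(X̂, ℤ) : d₁d_g·Λ_{E_δ}H^{m+2}(X̂, ℤ)]`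

[cite: Lange2023AbelianVarietiesComplex, §6.2.4 Prop. 6.2.20 (p. 310: "`F : Hᵖ(X, ℤ) → H^{2g−p}(X̂, ℤ)` is an isomorphism"); §6.2.3 Prop. 6.2.18 (p. 308); §2.5.1 Prop. 2.5.1 (p. 131)]
[cite: Polishchuk2007FourierStable, §1 (p. 3: "`F_d e F_d⁻¹ = −f`")]
[cite: Beauville1983FourierChow, Prop. 3 (p. 243)]
[cite: Voisin2002, §6.2.2 Lemma 6.24; §7.1.2]

Row g50-#7 of the `lit-hodgefound` p09 lineage: the LATTICE (integral-cohomology) form of row g50-#4. SETTING as there: `X = E/Φ(ℤ^ι)` with a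
Riemann form `θ = η = E` of type `(d₁, …, d_g)` (`IsPolarizationType Φ η d`, `d : Fin (j + 2) → ℕ`, `g = j + 2`; any lattice basis),
`Hᵏ(X, ℤ) = integralForms Φ k`, `Hᵏ(X̂, ℤ) = integralForms (dualPeriod Φ) k`, `F = fourierFormₗ Φ e` the `ℂ`-linear Fourier transform on
invariant forms (`= fourierForm Φ e rfl`), `L_θ = lefschetzPow η 1 : Hᵇ → H^{b+2}` (`x ↦ θ ∧ x`), `E_δ = d₁d_g·E^*` the dual polarisation
of `X̂`, `Λ_{E_δ} = lefschetzDual E_δ m`, `P^{m+2}(X̂, E_δ) = primitiveForms E_δ (m + 2)`.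

* §1 **`map_fourierFormₗ_integralForms`: `F(Hᵖ(X, ℤ)) = H^{2g−p}(X̂, ℤ)`** as an equality of subgroups (Prop. 6.2.20 as printed; the
  tree's `fourierForm_mem_integralForms` and `exists_fourierForm_eq_of_mem_integralForms` packaged).
* §2 **`IsPolarizationType.map_fourierFormₗ_integralForms_inf_ker_lefschetzPow`:
  `F(Hᵇ(X, ℤ) ∩ ker L_θ) = H^{m+2}(X̂, ℤ) ∩ P^{m+2}(X̂, E_δ)`** (`m + 2 ≤ g`) — the Fourier transform carries the integral classes
  killed by the polarisation onto the INTEGRAL `E_δ`-PRIMITIVE LATTICE of the dual polarised torus (row g50-#4 §4 and §1).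
* §3 **`IsPolarizationType.map_fourierFormₗ_map_lefschetzPow_integralForms`: `F(θ ∪ Hᵇ(X, ℤ)) = d₁d_g·Λ_{E_δ}(H^{m+2}(X̂, ℤ))`**
  (row g50-#4 §2 `F(θ ∪ x) = −d₁d_g·Λ_{E_δ}(F x)` and §1).
* §4 **`IsPolarizationType.relIndex_map_lefschetzPow_integralForms_eq_dual`:
  `[H^{b+2}(X, ℤ) : θ ∪ Hᵇ(X, ℤ)] = [Hᵐ(X̂, ℤ) : d₁d_g·Λ_{E_δ}(H^{m+2}(X̂, ℤ))]`** (`b + 2 + m = 2g`; relative indices, `0` when infinite) —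
  the cokernel of the Lefschetz operator on integral cohomology of `X` and the cokernel of `d₁d_g·Λ_{E_δ}` on integral cohomology of `X̂`
  have the same size (`F` is an injective homomorphism carrying the one pair of lattices onto the other).

## References

* [cite: Lange2023AbelianVarietiesComplex, §6.2.4 Prop. 6.2.20 (p. 310); §6.2.3 Prop. 6.2.18 (p. 308); §2.5.1 Prop. 2.5.1 (p. 131)]
* [cite: Polishchuk2007FourierStable, §1 (p. 3)]
* [cite: Beauville1983FourierChow, Prop. 3 (p. 243)]
* [cite: Voisin2002, §6.2.2 Lemma 6.24; §7.1.2]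
-/

noncomputable section

-- `Module ℂ` / `SMulZeroClass ℂ` synthesis on `E [⋀^Fin k]→L[ℝ] ℂ` (as in `ComplexTorusLefschetzDecomposition`)
set_option maxSynthPendingDepth 3

open Module Function Complex
open Literature.LinearAlgebra.Alternating

namespace Literature.Geometry.Kaehler.ComplexTorus

universe uE

/-! ## §0 Helpers -/

section Helpers

variable {E : Type uE} [NormedAddCommGroup E] [NormedSpace ℂ E]

/-- `θ^{∧1} = θ`. [folklore] -/
private theorem wedgePow_one_eq_self₁₀₉ (θ : E [⋀^Fin 2]→L[ℝ] ℂ) : wedgePow θ 1 = θ := by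
  rw [wedgePow_one, Literature.Analysis.Complex.oneForm₀, ContinuousAlternatingMap.constOfIsEmpty_one_wedge]
  ext v
  rfl

/-- The Lefschetz operator `L_θ = lefschetzPow η 1` with target degree `2 + b` is `x ↦ θ ∧ x`. [cite: Voisin2002, §6.2.1] -/
private theorem lefschetzPow_one_eq_wedge₁₀₉ (η : E [⋀^Fin 2]→L[ℝ] ℝ) {b : ℕ} (hL : 2 * 1 + b = 2 + b)
    (x : E [⋀^Fin b]→L[ℝ] ℂ) : lefschetzPow η 1 hL x = (ofRealForm η).wedge x := by
  rw [lefschetzPow_apply, wedgePow_one_eq_self₁₀₉]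
  rfl

end Helpers

/-! ## §1 `F(Hᵖ(X, ℤ)) = H^{2g−p}(X̂, ℤ)` -/

section Integral

variable {ι : Type*} [Fintype ι] [LinearOrder ι] {E : Type uE} [NormedAddCommGroup E] [NormedSpace ℂ E]
  (Φ : (ι → ℝ) ≃L[ℝ] E)

/-- **Proposition 6.2.20: `F(Hᵖ(X, ℤ)) = H^{2g−p}(X̂, ℤ)`** — the cohomological Fourier transform restricts to an isomorphism of the
integral lattices ("`F : Hᵖ(X, ℤ) → H^{2g−p}(X̂, ℤ)` is an isomorphism"), stated as an equality of subgroups of `H^{2g−p}(X̂, ℂ)` (the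
tree's `fourierForm_mem_integralForms` / `exists_fourierForm_eq_of_mem_integralForms`; injectivity is `fourierForm_injective`).
[cite: Lange2023AbelianVarietiesComplex, §6.2.4 Prop. 6.2.20 (p. 310)] [cite: Beauville1983FourierChow, Prop. 3 (p. 243)] -/
theorem map_fourierFormₗ_integralForms {p m : ℕ} (e : Fin (p + m) ≃ ι) :
    (integralForms Φ p).map (fourierFormₗ Φ e).toAddMonoidHom = integralForms (dualPeriod Φ) m := by
  ext y
  simp only [AddSubgroup.mem_map, LinearMap.toAddMonoidHom_coe, fourierFormₗ_apply]
  constructor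
  · rintro ⟨x, hx, rfl⟩
    exact fourierForm_mem_integralForms Φ e hx
  · intro hy
    obtain ⟨x, hx, hxy⟩ := exists_fourierForm_eq_of_mem_integralForms Φ e hy
    exact ⟨x, hx, hxy⟩

end Integral

/-! ## §2–§4 The Lefschetz lattices under `F` -/

section Lefschetz

variable {ι : Type*} [Fintype ι] [LinearOrder ι] {E : Type uE} [NormedAddCommGroup E] [NormedSpace ℂ E]
  [FiniteDimensional ℂ (E →L⋆[ℂ] ℂ)] (Φ : (ι → ℝ) ≃L[ℝ] E) {j : ℕ} {η : E [⋀^Fin 2]→L[ℝ] ℝ} {d : Fin (j + 2) → ℕ}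

/-- **`F(Hᵇ(X, ℤ) ∩ ker L_θ) = H^{m+2}(X̂, ℤ) ∩ P^{m+2}(X̂, E_δ)`** (`m + 2 ≤ g`): the Fourier transform carries the integral classes of `X`
killed by `x ↦ θ ∪ x` onto the integral `E_δ`-primitive classes of the dual polarised torus `(X̂, E_δ)` (`θ ∪ x = 0 ↔ F x ∈ P(X̂, E_δ)`,
row g50-#4, and `F(Hᵇ(X, ℤ)) = H^{m+2}(X̂, ℤ)`, Prop. 6.2.20). [cite: Lange2023AbelianVarietiesComplex, §6.2.4 Prop. 6.2.20 (p. 310); §6.2.3 Prop. 6.2.18 (b)]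
[cite: Polishchuk2007FourierStable, §1 (p. 3)] [cite: Voisin2002, §6.2.2 Lemma 6.24; §7.1.2] -/
theorem IsPolarizationType.map_fourierFormₗ_integralForms_inf_ker_lefschetzPow (hd : IsPolarizationType Φ η d)
    (hη : IsRiemannForm Φ η) {b m : ℕ} (hm : m ≤ j) (hL : 2 * 1 + b = 2 + b) (e_b : Fin (b + (m + 2)) ≃ ι) :
    (integralForms Φ b ⊓ (LinearMap.ker (lefschetzPow η 1 hL)).toAddSubgroup).map (fourierFormₗ Φ e_b).toAddMonoidHom =
      integralForms (dualPeriod Φ) (m + 2) ⊓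
        (primitiveForms (((d 0 * d (Fin.last (j + 1)) : ℕ) : ℝ) • dualForm Φ hη.1 hη.nondegenerate) (m + 2)).toAddSubgroup := by
  -- `θ ∧ x = 0 ↔ F x ∈ P`, for integral (hence rational) `x`
  have key : ∀ x : E [⋀^Fin b]→L[ℝ] ℂ, x ∈ integralForms Φ b →
      ((ofRealForm η).wedge x = 0 ↔ fourierForm Φ e_b rfl x ∈
        primitiveForms (((d 0 * d (Fin.last (j + 1)) : ℕ) : ℝ) • dualForm Φ hη.1 hη.nondegenerate) (m + 2)) := by
    intro x hx
    have h := hd.cupProduct_ratClass_eq_zero_iff_fourierForms_mem_primitiveForms Φ hη hm e_b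
      ⟨x, mem_rationalForms_of_mem_integralForms Φ hx⟩
    rw [Subtype.ext_iff, coe_cupProduct_rfl, IsNSForm.coe_ratClass, Submodule.coe_zero, coe_fourierForms_apply] at h
    exact h
  ext y
  simp only [AddSubgroup.mem_map, AddSubgroup.mem_inf, Submodule.mem_toAddSubgroup, LinearMap.mem_ker,
    LinearMap.toAddMonoidHom_coe, fourierFormₗ_apply, lefschetzPow_one_eq_wedge₁₀₉ η hL]
  constructor
  · rintro ⟨x, ⟨hx, hx0⟩, rfl⟩
    exact ⟨fourierForm_mem_integralForms Φ e_b hx, (key x hx).1 hx0⟩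
  · rintro ⟨hy, hyP⟩
    obtain ⟨x, hx, hxy⟩ := exists_fourierForm_eq_of_mem_integralForms Φ e_b hy
    exact ⟨x, ⟨hx, (key x hx).2 (hxy ▸ hyP)⟩, hxy⟩

/-- **`F(θ ∪ Hᵇ(X, ℤ)) = d₁d_g · Λ_{E_δ}(H^{m+2}(X̂, ℤ))`** (`b + 2 + m = 2g`, every lattice basis, every frame `e_F`): the Fourier transform
carries the image of the Lefschetz operator `L_θ` on the integral cohomology of `X` onto the image of `d₁d_g·Λ_{E_δ}` on the integral
cohomology of `X̂` (row g50-#4 §2 `F(θ ∪ x) = −d₁d_g·Λ_{E_δ}(F x)` and `F(Hᵇ(X, ℤ)) = H^{m+2}(X̂, ℤ)`, Prop. 6.2.20).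
[cite: Polishchuk2007FourierStable, §1 (p. 3)] [cite: Lange2023AbelianVarietiesComplex, §6.2.4 Prop. 6.2.20 (p. 310); §6.2.3 Prop. 6.2.18 (b) (p. 308); §2.5.1 Prop. 2.5.1] -/
theorem IsPolarizationType.map_fourierFormₗ_map_lefschetzPow_integralForms (hd : IsPolarizationType Φ η d)
    (hη : IsRiemannForm Φ η) {b m : ℕ} (hL : 2 * 1 + b = 2 + b) (e_F : Fin ((2 + b) + m) ≃ ι) :
    ((integralForms Φ b).map (lefschetzPow η 1 hL).toAddMonoidHom).map (fourierFormₗ Φ e_F).toAddMonoidHom =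
      (integralForms (dualPeriod Φ) (m + 2)).map
        ((((d 0 * d (Fin.last (j + 1)) : ℕ) : ℂ)) •
          lefschetzDual (((d 0 * d (Fin.last (j + 1)) : ℕ) : ℝ) • dualForm Φ hη.1 hη.nondegenerate) m).toAddMonoidHom := by
  have hcard : Fintype.card ι = 2 * (j + 2) := hd.card_eq
  have hbm : (2 + b) + m = 2 * (j + 2) := by
    have h1 := Fintype.card_congr e_F
    simp only [Fintype.card_fin] at h1
    omega
  -- auxiliary frames (the statement does not depend on them)
  let eₐ : Fin (2 + 2 * (j + 1)) ≃ ι := (Fintype.equivFinOfCardEq (by omega)).symm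
  let e_b : Fin (b + (m + 2)) ≃ ι := (Fintype.equivFinOfCardEq (by omega)).symm
  let Ê₂ : Fin ((2 * (j + 1) + (m + 2)) + (2 + b)) ≃ ι ⊕ ι :=
    (Fintype.equivFinOfCardEq (by rw [Fintype.card_sum]; omega)).symm
  let ê : Fin (m + (2 + b)) ≃ ι := (Fintype.equivFinOfCardEq (by omega)).symm
  -- `F(θ ∧ x) = −d₁d_g·Λ_{E_δ}(F x)` for integral (hence rational) `x`
  have key : ∀ x : E [⋀^Fin b]→L[ℝ] ℂ, x ∈ integralForms Φ b →
      fourierForm Φ e_F rfl ((ofRealForm η).wedge x) =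
        -(((d 0 * d (Fin.last (j + 1)) : ℕ) : ℂ)) •
          lefschetzDual (((d 0 * d (Fin.last (j + 1)) : ℕ) : ℝ) • dualForm Φ hη.1 hη.nondegenerate) m
            (fourierForm Φ e_b rfl x) := by
    intro x hx
    have h := hd.coe_fourierForms_cupProduct_ratClass Φ hη eₐ e_b Ê₂ ê e_F ⟨x, mem_rationalForms_of_mem_integralForms Φ hx⟩
    rw [coe_fourierForms_apply, coe_cupProduct_rfl, IsNSForm.coe_ratClass, coe_fourierForms_apply] at h
    exact h
  ext z
  simp only [AddSubgroup.mem_map, LinearMap.toAddMonoidHom_coe, fourierFormₗ_apply, LinearMap.smul_apply,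
    lefschetzPow_one_eq_wedge₁₀₉ η hL, exists_exists_and_eq_and]
  constructor
  · rintro ⟨x, hx, rfl⟩
    refine ⟨-fourierForm Φ e_b rfl x, neg_mem (fourierForm_mem_integralForms Φ e_b hx), ?_⟩
    rw [key x hx, map_neg, smul_neg, neg_smul]
  · rintro ⟨y, hy, rfl⟩
    obtain ⟨x, hx, hxy⟩ := exists_fourierForm_eq_of_mem_integralForms Φ e_b (neg_mem hy)
    refine ⟨x, hx, ?_⟩
    rw [key x hx, hxy, map_neg, smul_neg, neg_smul, neg_neg]

/-- **`[H^{b+2}(X, ℤ) : θ ∪ Hᵇ(X, ℤ)] = [Hᵐ(X̂, ℤ) : d₁d_g·Λ_{E_δ}(H^{m+2}(X̂, ℤ))]`** (`b + 2 + m = 2g`; relative indices in the sense of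
Mathlib's `AddSubgroup.relIndex`, `0` if infinite): the cokernel of the Lefschetz operator `L_θ` on the integral cohomology of `X` and the
cokernel of `d₁d_g·Λ_{E_δ}` on the integral cohomology of `X̂` have the same order — `F` is an injective homomorphism
(`fourierForm_injective`) with `F(H^{b+2}(X, ℤ)) = Hᵐ(X̂, ℤ)` (§1) and `F(θ ∪ Hᵇ(X, ℤ)) = d₁d_g·Λ_{E_δ}(H^{m+2}(X̂, ℤ))` (§3).
[cite: Lange2023AbelianVarietiesComplex, §6.2.4 Prop. 6.2.20 (p. 310)] [cite: Polishchuk2007FourierStable, §1 (p. 3)] -/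
theorem IsPolarizationType.relIndex_map_lefschetzPow_integralForms_eq_dual (hd : IsPolarizationType Φ η d)
    (hη : IsRiemannForm Φ η) {b m : ℕ} (hL : 2 * 1 + b = 2 + b) (e_F : Fin ((2 + b) + m) ≃ ι) :
    ((integralForms Φ b).map (lefschetzPow η 1 hL).toAddMonoidHom).relIndex (integralForms Φ (2 + b)) =
      ((integralForms (dualPeriod Φ) (m + 2)).map
          ((((d 0 * d (Fin.last (j + 1)) : ℕ) : ℂ)) •
            lefschetzDual (((d 0 * d (Fin.last (j + 1)) : ℕ) : ℝ) • dualForm Φ hη.1 hη.nondegenerate) m).toAddMonoidHom).relIndex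
        (integralForms (dualPeriod Φ) m) := by
  rw [← hd.map_fourierFormₗ_map_lefschetzPow_integralForms Φ hη hL e_F, ← map_fourierFormₗ_integralForms Φ e_F,
    AddSubgroup.relIndex_map_map_of_injective _ _ (fourierForm_injective Φ e_F)]

end Lefschetz

end Literature.Geometry.Kaehler.ComplexTorus

end
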